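import Summits.KontsevichZagierPeriods.KontsevichZagierPeriods.Theorems.BetaCancellation.Negative.PiLinkReps

/-!
# `BetaCancellation` (stmt-KontsevichZagierPeriods-13633) — `[β(1/2,1/2)] ∼ [π]`, moves 2–3

Continuation of `Negative/PiLinkReps.lean` (`betaHalfRep`, `invSqrtRep`, move 1). Here:
Kontsevich–Zagier's own §1.1 step `∫_{-1}^{1} dx/√(1−x²) = ∫_{-1}^{1} 2√(1−x²) dx` inside the
calculus — `twoSqrtRep`, `derivRep` (the derivative `(2x²−1)/√(1−x²)` of the primitive
`−x√(1−x²)` on the closed band), move 2 (`derivRep_sub_zeroRep0_mem`, ONE Newton–Leibniz move from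
the point), move 3 (`invSqrtRep_sub_twoSqrtRep_sub_mem`, ONE integrand-additivity move), and
`equivalent_invSqrtRep_twoSqrtRep`. Concluded in `Negative/PiLink.lean`.
cdisprove (refuter) file; sorry-free, axioms ⊆ {propext, Classical.choice, Quot.sound}.
[Kontsevich–Zagier 2001, §1.1]
-/

noncomputable section

set_option linter.dupNamespace false

namespace Summit.KontsevichZagierPeriods.KontsevichZagierPeriods.BetaCancellationNegative

open MeasureTheory Set
open Literature.NumberTheory.Transcendental
open Literature.NumberTheory.Transcendental.KZ
open Literature.ModelTheory.ExponentialFields (IsSemialgebraic isSemialgebraic_univ)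
open MvPolynomial (aeval X C)
open Summit.KontsevichZagierPeriods.KontsevichZagierPeriods.Theses.TerasomaMultiplication
  (BetaCancellation)
open Literature.NumberTheory.Transcendental.KZreg (unitIoo isSemialgebraic_unitIoo volume_unitIoo)

/-! ## `[β(1/2,1/2)] ∼ [π]`: moves 2–3 -/

/-! ### §4 Moves 2–3 (rule 3, rule 1): KZ's §1.1 step `∫ dx/√(1−x²) = ∫ 2√(1−x²) dx` -/

/-- **`[(-1,1), 2√(1-x²)]`**. [cite: KontsevichZagier2001, §1.1] -/
def twoSqrtRep : IntegralRep 1 where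
  domain := symIoo
  integrand := fun x => 2 * √(1 - x 0 ^ 2)
  isSemialgebraic_domain := isSemialgebraic_symIoo
  isSemialgebraicFunOn_integrand := by
    have h1 : IsSemialgebraicFunOn ℚ symIoo
        (fun x => √(aeval x (1 - X 0 ^ 2 : MvPolynomial (Fin 1) ℚ))) :=
      IsSemialgebraicFunOn.sqrt_holds (isSemialgebraicFunOn_aeval isSemialgebraic_symIoo _)
    refine (IsSemialgebraicFunOn.mul_holds (isSemialgebraicFunOn_natCast isSemialgebraic_symIoo 2)
      h1).congr fun x _ => ?_
    simp only [Pi.mul_apply, map_sub, map_one, map_pow, MvPolynomial.aeval_X, Nat.cast_ofNat]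
  integrableOn := integrableOn_symIoo_of_continuous (by fun_prop)

/-- The domain of `twoSqrtRep`. [folklore] -/
@[simp] theorem twoSqrtRep_domain : twoSqrtRep.domain = symIoo := rfl

/-- The integrand of `twoSqrtRep`. [folklore] -/
@[simp] theorem twoSqrtRep_integrand : twoSqrtRep.integrand = fun x => 2 * √(1 - x 0 ^ 2) := rfl

/-- `1/√u − 2√u = (2x² − 1)/√u` when `u = 1 − x² > 0`. [folklore] -/
theorem inv_sqrt_sub_two_sqrt {u x2 : ℝ} (hu : 0 < u) (hx : u = 1 - x2) :
    (√u)⁻¹ - 2 * √u = (2 * x2 - 1) * (√u)⁻¹ := by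
  have hs : √u ≠ 0 := (Real.sqrt_pos.2 hu).ne'
  have hsq : √u * √u = u := Real.mul_self_sqrt hu.le
  calc (√u)⁻¹ - 2 * √u = (√u)⁻¹ - 2 * √u * (√u * (√u)⁻¹) := by rw [mul_inv_cancel₀ hs, mul_one]
    _ = (1 - 2 * (√u * √u)) * (√u)⁻¹ := by ring
    _ = (2 * x2 - 1) * (√u)⁻¹ := by rw [hsq, hx]; ring

/-- `d/dt (−t√(1−t²)) = (2t²−1)/√(1−t²)` on `(−1,1)`. [folklore] -/
theorem hasDerivAt_neg_mul_sqrt {t : ℝ} (ht : t ∈ Ioo (-1:ℝ) 1) :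
    HasDerivAt (fun s : ℝ => -s * √(1 - s ^ 2)) ((2 * t ^ 2 - 1) * (√(1 - t ^ 2))⁻¹) t := by
  have hu : HasDerivAt (fun s : ℝ => 1 - s ^ 2) (-(2 * t)) t := by
    simpa using ((hasDerivAt_pow 2 t).const_sub 1)
  have hpos : 0 < 1 - t ^ 2 := by nlinarith [ht.1, ht.2]
  have hs := hu.sqrt hpos.ne'
  have hF := (hasDerivAt_id' t).neg.mul hs
  refine hF.congr_deriv ?_
  have hs0 : √(1 - t ^ 2) ≠ 0 := (Real.sqrt_pos.2 hpos).ne'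
  have hsq : √(1 - t ^ 2) * √(1 - t ^ 2) = 1 - t ^ 2 := Real.mul_self_sqrt hpos.le
  calc -1 * √(1 - t ^ 2) + -t * (-(2 * t) / (2 * √(1 - t ^ 2)))
        = -√(1 - t ^ 2) * (√(1 - t ^ 2) * (√(1 - t ^ 2))⁻¹) + t ^ 2 * (√(1 - t ^ 2))⁻¹ := by
        rw [mul_inv_cancel₀ hs0]; ring
    _ = (-(√(1 - t ^ 2) * √(1 - t ^ 2)) + t ^ 2) * (√(1 - t ^ 2))⁻¹ := by ring
    _ = (2 * t ^ 2 - 1) * (√(1 - t ^ 2))⁻¹ := by rw [hsq]; ring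

/-- **`[[-1,1], (2x²−1)/√(1−x²)]`**: the derivative of the primitive `−x√(1−x²)` on the CLOSED
band of the Newton–Leibniz move (junk value `0` at `x = ±1`, where `(√0)⁻¹ = 0`). [folklore] -/
def derivRep : IntegralRep 1 where
  domain := symIcc
  integrand := fun x => (2 * x 0 ^ 2 - 1) * (√(1 - x 0 ^ 2))⁻¹
  isSemialgebraic_domain := isSemialgebraic_symIcc
  isSemialgebraicFunOn_integrand := by
    have hE : IsSemialgebraic ℚ (symIcc \ symIoo) := isSemialgebraic_symIcc.diff isSemialgebraic_symIoo
    have h1 : IsSemialgebraicFunOn ℚ symIoo (fun x => (2 * x 0 ^ 2 - 1) * (√(1 - x 0 ^ 2))⁻¹) := by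
      have ha : IsSemialgebraicFunOn ℚ symIoo (fun x : Fin 1 → ℝ => 2 * x 0 ^ 2 - 1) :=
        (isSemialgebraicFunOn_aeval isSemialgebraic_symIoo (2 * X 0 ^ 2 - 1)).congr fun x _ => by
          simp
      have hb : IsSemialgebraicFunOn ℚ symIoo (fun x : Fin 1 → ℝ => (√(1 - x 0 ^ 2))⁻¹) :=
        isSemialgebraicFunOn_of_eqOn_inv_sqrt isSemialgebraic_symIoo (1 - X 0 ^ 2)
          (fun x hx => by
            simp only [mem_symIoo, mem_Ioo] at hx
            simp only [map_sub, map_one, map_pow, MvPolynomial.aeval_X]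
            nlinarith)
          (fun x _ => by simp)
      exact IsSemialgebraicFunOn.mul_holds ha hb
    have h2 : IsSemialgebraicFunOn ℚ (symIcc \ symIoo) (fun _ => (0:ℝ)) :=
      (isSemialgebraicFunOn_aeval hE 0).congr fun x _ => by simp
    have hU : symIcc = symIoo ∪ (symIcc \ symIoo) := by
      ext x
      simp only [mem_union, mem_sdiff]
      constructor
      · intro h
        by_cases h' : x ∈ symIoo
        · exact Or.inl h'
        · exact Or.inr ⟨h, h'⟩
      · rintro (h | h)
        · exact symIoo_subset_symIcc h
        · exact h.1
    rw [hU]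
    refine IsSemialgebraicFunOn.union h1 h2 (fun x _ => rfl) (fun x hx => ?_)
    simp only [mem_sdiff, mem_symIcc, mem_Icc, mem_symIoo, mem_Ioo, not_and, not_lt] at hx
    obtain ⟨⟨h1', h2'⟩, h3⟩ := hx
    have hx0 : x 0 ^ 2 = 1 := by
      rcases h1'.lt_or_eq with h | h
      · rw [le_antisymm h2' (h3 h)]; norm_num
      · rw [← h]; norm_num
    simp [hx0]
  integrableOn := by
    have hmeas : MeasurableSet symIoo :=
      Literature.ModelTheory.ExponentialFields.IsSemialgebraic.measurableSet_holds
        isSemialgebraic_symIoo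
    have h1 : IntegrableOn (fun x : Fin 1 → ℝ => (2 * x 0 ^ 2 - 1) * (√(1 - x 0 ^ 2))⁻¹) symIoo := by
      refine (invSqrtRep.integrableOn.sub twoSqrtRep.integrableOn).congr_fun (fun x hx => ?_) hmeas
      have hx' : x ∈ symIoo := hx
      rw [Pi.sub_apply, invSqrtRep_integrand_eq hx', twoSqrtRep_integrand]
      simp only [mem_symIoo, mem_Ioo] at hx'
      exact inv_sqrt_sub_two_sqrt (by nlinarith) rfl
    refine h1.congr_set_ae (ae_eq_set.2 ⟨volume_symIcc_diff_symIoo, ?_⟩)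
    exact measure_mono_null (fun x hx => (hx.2 (symIoo_subset_symIcc hx.1)).elim) measure_empty

/-- The domain of `derivRep`. [folklore] -/
@[simp] theorem derivRep_domain : derivRep.domain = symIcc := rfl

/-- The integrand of `derivRep`. [folklore] -/
@[simp] theorem derivRep_integrand :
    derivRep.integrand = fun x => (2 * x 0 ^ 2 - 1) * (√(1 - x 0 ^ 2))⁻¹ := rfl

/-- On `ℝ⁰⁺¹`, `Fin.snoc x s 0 = s`. [folklore] -/
@[simp] theorem snoc_zero_apply_zero (x : Fin 0 → ℝ) (s : ℝ) : (Fin.snoc x s : Fin 1 → ℝ) 0 = s := by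
  rw [show (0 : Fin 1) = Fin.last 0 from rfl, Fin.snoc_last]

/-- The zero representation on the point `ℝ⁰`. [folklore] -/
def zeroRep0 : IntegralRep 0 where
  domain := univ
  integrand := 0
  isSemialgebraic_domain := isSemialgebraic_univ
  isSemialgebraicFunOn_integrand :=
    (isSemialgebraicFunOn_aeval isSemialgebraic_univ 0).congr fun x _ => by simp
  integrableOn := integrableOn_zero

/-- `[pt, 0]` is a relation. [folklore] -/
theorem of_zeroRep0_mem_relations : of zeroRep0 ∈ relations :=
  of_mem_relations_of_eqOn_zero zeroRep0 fun _ _ => rfl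

/-- **Move 2 (rule 3)**: `[[-1,1], (2x²−1)/√(1−x²)] − [pt, 0]` is ONE Newton–Leibniz move with
primitive `F(x) = −x√(1−x²)` (continuous on `[−1,1]`, differentiable inside, `F(±1) = 0`).
[cite: KontsevichZagier2001, §1.1] -/
theorem derivRep_sub_zeroRep0_mem : of derivRep - of zeroRep0 ∈ newtonLeibnizRel := by
  refine ⟨0, derivRep, zeroRep0, fun _ => (-1:ℝ), fun _ => (1:ℝ),
    fun z => -z (Fin.last 0) * √(1 - z (Fin.last 0) ^ 2), ?_, ?_, ?_, fun _ _ => by norm_num,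
    ?_, ?_, ?_, ?_, rfl⟩
  · have ha : IsSemialgebraicFunOn ℚ symIcc (fun z : Fin 1 → ℝ => -z (Fin.last 0)) :=
      (isSemialgebraicFunOn_aeval isSemialgebraic_symIcc (-X (Fin.last 0))).congr fun z _ => by
        simp
    have hb : IsSemialgebraicFunOn ℚ symIcc (fun z : Fin 1 → ℝ => √(1 - z (Fin.last 0) ^ 2)) :=
      (IsSemialgebraicFunOn.sqrt_holds (isSemialgebraicFunOn_aeval isSemialgebraic_symIcc
        (1 - X (Fin.last 0) ^ 2))).congr fun z _ => by simp
    exact IsSemialgebraicFunOn.mul_holds ha hb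
  · exact (isSemialgebraicFunOn_aeval isSemialgebraic_univ (-1 : MvPolynomial (Fin 0) ℚ)).congr
      fun x _ => by simp
  · exact (isSemialgebraicFunOn_aeval isSemialgebraic_univ (1 : MvPolynomial (Fin 0) ℚ)).congr
      fun x _ => by simp
  · ext z
    simp only [derivRep_domain, mem_setOf_eq, zeroRep0, mem_univ, true_and]
    rfl
  · intro x _
    simp only [Fin.snoc_last]
    exact (by fun_prop : Continuous fun t : ℝ => -t * √(1 - t ^ 2)).continuousOn
  · intro x _ t ht
    simp only [Fin.snoc_last, derivRep_integrand]
    rw [show (0 : Fin 1) = Fin.last 0 from rfl, Fin.snoc_last]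
    exact hasDerivAt_neg_mul_sqrt ht
  · intro x _
    simp [zeroRep0]

/-- `[(-1,1), (2x²−1)/√(1−x²)]` (the open restriction of `derivRep`) is a relation. [folklore] -/
theorem of_derivRep_restrict_mem_relations :
    of (derivRep.restrict symIoo isSemialgebraic_symIoo symIoo_subset_symIcc) ∈ relations := by
  have h1 : of derivRep - of (derivRep.restrict symIoo isSemialgebraic_symIoo symIoo_subset_symIcc)
      ∈ relations :=
    derivRep.of_sub_of_restrict_mem_relations isSemialgebraic_symIoo symIoo_subset_symIcc
      volume_symIcc_diff_symIoo
  have h2 : of derivRep ∈ relations := by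
    have := relations.add_mem (newtonLeibnizRel_subset_relations derivRep_sub_zeroRep0_mem)
      of_zeroRep0_mem_relations
    simpa using this
  have := relations.sub_mem h2 h1
  simpa using this

/-- **Move 3 (rule 1)**: `[(-1,1), 1/√(1−x²)] − [(-1,1), 2√(1−x²)] − [(-1,1), (2x²−1)/√(1−x²)]`
is ONE integrand-additivity move. [cite: KontsevichZagier2001, §1.1] -/
theorem invSqrtRep_sub_twoSqrtRep_sub_mem :
    of invSqrtRep - of twoSqrtRep -
      of (derivRep.restrict symIoo isSemialgebraic_symIoo symIoo_subset_symIcc) ∈ integrandAddRel := by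
  refine ⟨1, invSqrtRep, twoSqrtRep,
    derivRep.restrict symIoo isSemialgebraic_symIoo symIoo_subset_symIcc, rfl, rfl,
    fun x hx => ?_, rfl⟩
  have hx' : x ∈ symIoo := hx
  rw [Pi.add_apply, invSqrtRep_integrand_eq hx', twoSqrtRep_integrand, IntegralRep.integrand_restrict,
    derivRep_integrand]
  simp only [mem_symIoo, mem_Ioo] at hx'
  have := inv_sqrt_sub_two_sqrt (u := 1 - x 0 ^ 2) (x2 := x 0 ^ 2) (by nlinarith) rfl
  linarith

/-- **`[(-1,1), 1/√(1−x²)] ∼ [(-1,1), 2√(1−x²)]`** (Kontsevich–Zagier's §1.1 example, inside the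
calculus: moves 2 and 3). [cite: KontsevichZagier2001, §1.1] -/
theorem equivalent_invSqrtRep_twoSqrtRep : Equivalent invSqrtRep twoSqrtRep := by
  have h1 := integrandAddRel_subset_relations invSqrtRep_sub_twoSqrtRep_sub_mem
  have h2 := of_derivRep_restrict_mem_relations
  have := relations.add_mem h1 h2
  simpa [Equivalent] using this

end Summit.KontsevichZagierPeriods.KontsevichZagierPeriods.BetaCancellationNegative
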